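import Literature.IUT.LogVolume.WildCubicExistence
import Literature.IUT.LogVolume.TensorPacketMeasure
import Mathlib.LinearAlgebra.Reflection
import Mathlib.Tactic.Module
import HarnessLib

/-!
# A wild isometry MOVING the maximal order of a tensor packet: `K = ℚ₃(∛3)`, `(g ⊗ 1)((R_I)^∼) ≠ (R_I)^∼`

Classical local algebra (nothing disputed; the [IUTchIV] locator records where the abc-iut cell uses it).
[IUTchIV] Prop. 1.1 p. 9 attaches to a tensor packet `V = ⊗_{ℚ_p} k_i` the integral structure `R_I = ⊗_{ℤ_p} R_i`
and its normalisation `(R_I)^∼` — the MAXIMAL `ℤ_p`-order of `V` (the integral closure of `ℤ_p`; under any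
decomposition `ψ : V ≅ Π_j L_j` into fields, `ψ((R_I)^∼) = Π_j 𝒪_{L_j}`, the tree's `image_normalizedPacket_eq_coe`).
A `ℚ_p`-ALGEBRA automorphism of `V` (e.g. `σ ⊗ 1` for a field automorphism `σ`) preserves `(R_I)^∼`; a unit
multiplication preserves it; and at TAMELY ramified factors so does `g ⊗ 1` for every `ℚ_p`-linear isometry `g` of a
factor (there `(R_I)^∼ = Σ p^{−⌊(i+j)/e⌋} 𝔪^i ⊗ 𝔪^j` is filtration-stable).  THIS FILE shows that the last statement
FAILS at a WILDLY ramified factor, in the smallest odd example — the field `K = ℚ₃(π)`, `π³ = 3` of abc-iut-S1's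
`WildCubicCoordinates` / `WildShellObstruction`:

* `norm_dEquiv_le_one_of_mem_normalizedPacket`, `algebraMap_not_mem_normalizedPacket` (any packet) — a point of
  `(R_I)^∼` has all field-factor coordinates of norm `≤ 1`; a scalar `c ∈ ℚ_p` with `‖c‖ > 1` is not in `(R_I)^∼`;
* `congr_pair_purePacket`, `congr_pair_wildIdempotent` — for ANY `ℚ₃`-linear `f₀, f₁ : K ≃ K` with `f₀ 1 = −1`,
  `f₀ π = π`, `f₀ π² = π²`, `f₁ = id` on `1, π, π²`... (precisely: `f₁` the identity), the map `f₀ ⊗ f₁` of `K ⊗_{ℚ₃} K`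
  sends abc-iut-S1's integral idempotent `e₁ = (3·1⊗1 + π²⊗π + π⊗π²)/9` (`wildIdempotent_mem_normalizedPacket`) to
  `e₁ − (2/3)·1`;
* **`congr_pair_wildIdempotent_not_mem`**, **`exists_mem_normalizedPacket_congr_not_mem`**,
  **`congr_image_normalizedPacket_ne`** — hence `(f₀ ⊗ 1)(e₁) ∉ (R_I)^∼` (else `(2/3)·1 ∈ (R_I)^∼`, but
  `‖2/3‖₃ = 3`): `f₀ ⊗ 1` does NOT map `(R_I)^∼` onto itself;
* **`exists_reflection_isometry`** — for `[K : ℚ₃] = 3` such an `f₀` EXISTS as an ISOMETRY: the coordinate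
  reflection `a + bπ + cπ² ↦ −a + bπ + cπ²` (Mathlib `Module.reflection` in the vector `1` and the form `2·x₀`) has
  `‖f₀ x‖ = ‖x‖` (`WildCubic.norm_combo`: the norm is the max of the coordinate sizes), so it maps every closed ball
  `B(0, r)` — `𝒪_K`, every `𝔪_K^n` — onto itself (`image_closedBall_eq_of_norm_map_eq`);
* **`exists_wildCubic_isometry_maxOrder_mover`** — NON-VACUITY inside `ℚ̄₃`: for the finite `E = ℚ₃(∛3) ⊆ ℚ̄₃` of
  `exists_wildCubic_subfield` there is a `ℚ₃`-linear isometry `g` of `E` with `(g ⊗ 1)((R_I)^∼) ≠ (R_I)^∼` in `E ⊗_{ℚ₃} E`.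

Use (abc-iut cell, R-J row Y-29b): «𝒪_v-stable `ℚ_p`-linear ISOMETRIES as the (Ind2)-binder» do NOT in general fix
the maximal-order boxes `e⁻¹(𝒪_L)` of the tensor packets — the sign boundary is «wild», not «dyadic».  This is a
statement about CONTAINERS only; it takes no side on [IUTchIII] Cor. 3.12.  Proof-only file (theorems, no definitions).
[cite: Mochizuki2012, IUTchIV Prop. 1.1 p. 9, Prop. 1.4 (i) p. 13] [cite: NeukirchANT1999, Ch. II (5.5)]
[cite: SerreLocalFields1979, Ch. III §6 Prop. 12]
-/

noncomputable section

open Metric Set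
open scoped TensorProduct Pointwise

namespace Literature.IUT.LogVolume

/-! ## Field-factor coordinates of `(R_I)^∼`; scalars of norm `> 1` are not integral -/

section General

variable (p : ℕ) [Fact p.Prime] {I : Type} [Fintype I] [DecidableEq I] [Nonempty I]
variable (k : I → Type) [∀ i, NontriviallyNormedField (k i)] [∀ i, NormedAlgebra ℚ_[p] (k i)]
  [∀ i, IsUltrametricDist (k i)] [∀ i, ProperSpace (k i)]

/-- A point of `(R_I)^∼` has every field-factor coordinate of norm `≤ 1` (`ψ((R_I)^∼) = Π_j 𝒪_{L_j}`).
[cite: Mochizuki2012, IUTchIV Prop. 1.4 (i) p. 13] -/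
theorem norm_dEquiv_le_one_of_mem_normalizedPacket {x : PacketAlgebra p k} (hx : x ∈ normalizedPacket p k)
    (j : DIdx p k) : ‖dEquiv p k x j‖ ≤ 1 := by
  have h : dEquiv p k x ∈ (piUnitBallStructure (DFac p k) : Set (DSum p k)) := by
    rw [← image_normalizedPacket_eq_coe]
    exact ⟨x, hx, rfl⟩
  rw [coe_piUnitBallStructure, mem_polydisc] at h
  exact h j

/-- A scalar `c ∈ ℚ_p` with `‖c‖ > 1` is NOT in `(R_I)^∼` (its field-factor coordinates are all `c`).
[cite: Mochizuki2012, IUTchIV Prop. 1.4 (i) p. 13] -/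
theorem algebraMap_not_mem_normalizedPacket {c : ℚ_[p]} (hc : 1 < ‖c‖) :
    algebraMap ℚ_[p] (PacketAlgebra p k) c ∉ normalizedPacket p k := by
  intro h
  obtain ⟨j⟩ := nonempty_dIdx p k
  have h1 := norm_dEquiv_le_one_of_mem_normalizedPacket p k h j
  rw [AlgEquiv.commutes, Pi.algebraMap_apply, norm_algebraMap'] at h1
  exact not_lt.mpr h1 hc

/-- A `ℚ_p`-linear self-equivalence preserving the norm maps every closed ball `B(0, r)` ONTO itself (so an
isometry of a local field maps `𝒪` and every `𝔪^n` onto themselves). [cite: NeukirchANT1999, Ch. II (5.5)] -/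
theorem image_closedBall_eq_of_norm_map_eq {K : Type*} [NormedAddCommGroup K] [Module ℚ_[p] K]
    (g : K ≃ₗ[ℚ_[p]] K) (hg : ∀ x, ‖g x‖ = ‖x‖) (r : ℝ) :
    g '' closedBall (0 : K) r = closedBall 0 r := by
  ext y
  simp only [Set.mem_image, mem_closedBall_zero_iff]
  constructor
  · rintro ⟨x, hx, rfl⟩
    rwa [hg]
  · intro hy
    exact ⟨g.symm y, by rw [← hg (g.symm y), LinearEquiv.apply_symm_apply]; exact hy, g.apply_symm_apply y⟩

end General

/-! ## The wild example: `p = 3`, two factors `K = ℚ₃(π)`, `π³ = 3` -/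

section Wild

variable {K : Type} [NontriviallyNormedField K] [NormedAlgebra ℚ_[3] K] {π : K}

/-- `(f₀ ⊗ f₁)(x ⊗ y) = f₀ x ⊗ f₁ y` on the two-factor packet. [cite: Mochizuki2012, IUTchIV Prop. 1.1 p. 9] -/
theorem congr_pair_purePacket (f : ∀ _ : Fin 2, K ≃ₗ[ℚ_[3]] K) (x y : K) :
    (PiTensorProduct.congr f : PacketAlgebra 3 (fun _ : Fin 2 => K) ≃ₗ[ℚ_[3]] PacketAlgebra 3 (fun _ : Fin 2 => K))
        (purePacket 3 (fun _ : Fin 2 => K) ![x, y]) =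
      purePacket 3 (fun _ : Fin 2 => K) ![f 0 x, f 1 y] := by
  rw [purePacket, purePacket, PiTensorProduct.congr_tprod]
  congr 1
  funext i
  fin_cases i <;> rfl

/-- `3 = 3·(1 ⊗ 1)` in the packet. [cite: Mochizuki2012, IUTchIV Prop. 1.1 p. 9] -/
theorem three_eq_smul_purePacket_one :
    (3 : PacketAlgebra 3 (fun _ : Fin 2 => K)) = (3 : ℚ_[3]) • purePacket 3 (fun _ : Fin 2 => K) ![1, 1] := by
  have hone : (![(1 : K), 1] : Fin 2 → K) = 1 := by funext i; fin_cases i <;> rfl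
  rw [hone, purePacket_one, Algebra.smul_def, mul_one, map_ofNat]

/-- **`(f₀ ⊗ f₁)(e₁) = e₁ − (2/3)·1`** for the idempotent `e₁ = (3·1⊗1 + π²⊗π + π⊗π²)/9` of abc-iut-S1's
`WildShellObstruction` and ANY `ℚ₃`-linear `f₀`, `f₁` with `f₀ 1 = −1`, `f₀ π = π`, `f₀ π² = π²` and `f₁` fixing `1, π, π²`
(`f₀ ⊗ f₁` negates the summand `3·1⊗1/9 = (1/3)·1` and fixes the other two). [cite: Mochizuki2012, IUTchIV Prop. 1.1 p. 9] -/
theorem congr_pair_wildIdempotent (f : ∀ _ : Fin 2, K ≃ₗ[ℚ_[3]] K) (h0 : f 0 1 = -1) (h0π : f 0 π = π)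
    (h0π2 : f 0 (π ^ 2) = π ^ 2) (h1 : f 1 1 = 1) (h1π : f 1 π = π) (h1π2 : f 1 (π ^ 2) = π ^ 2) :
    (PiTensorProduct.congr f : PacketAlgebra 3 (fun _ : Fin 2 => K) ≃ₗ[ℚ_[3]] PacketAlgebra 3 (fun _ : Fin 2 => K))
        ((9 : ℚ_[3])⁻¹ • ((3 : PacketAlgebra 3 (fun _ : Fin 2 => K)) + purePacket 3 (fun _ : Fin 2 => K) ![π ^ 2, π]
          + purePacket 3 (fun _ : Fin 2 => K) ![π, π ^ 2])) =
      (9 : ℚ_[3])⁻¹ • ((3 : PacketAlgebra 3 (fun _ : Fin 2 => K)) + purePacket 3 (fun _ : Fin 2 => K) ![π ^ 2, π]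
          + purePacket 3 (fun _ : Fin 2 => K) ![π, π ^ 2]) -
        (2 / 3 : ℚ_[3]) • (1 : PacketAlgebra 3 (fun _ : Fin 2 => K)) := by
  set P11 := purePacket 3 (fun _ : Fin 2 => K) ![1, 1] with hP11
  set T21 := purePacket 3 (fun _ : Fin 2 => K) ![π ^ 2, π] with hT21
  set T12 := purePacket 3 (fun _ : Fin 2 => K) ![π, π ^ 2] with hT12
  have hone : P11 = 1 := by
    have h : (![(1 : K), 1] : Fin 2 → K) = 1 := by funext i; fin_cases i <;> rfl
    rw [hP11, h, purePacket_one]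
  have hG1 : (PiTensorProduct.congr f : PacketAlgebra 3 (fun _ : Fin 2 => K) ≃ₗ[ℚ_[3]] PacketAlgebra 3 (fun _ : Fin 2 => K))
      P11 = -P11 := by
    rw [hP11, congr_pair_purePacket, h0, h1,
      show (![(-1 : K), 1] : Fin 2 → K) = ![(-1 : ℚ_[3]) • (1 : K), (1 : ℚ_[3]) • (1 : K)] by
        rw [neg_one_smul, one_smul],
      purePacket_pair_smul, mul_one, neg_one_smul]
  have hG21 : (PiTensorProduct.congr f : PacketAlgebra 3 (fun _ : Fin 2 => K) ≃ₗ[ℚ_[3]] PacketAlgebra 3 (fun _ : Fin 2 => K))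
      T21 = T21 := by
    rw [hT21, congr_pair_purePacket, h0π2, h1π]
  have hG12 : (PiTensorProduct.congr f : PacketAlgebra 3 (fun _ : Fin 2 => K) ≃ₗ[ℚ_[3]] PacketAlgebra 3 (fun _ : Fin 2 => K))
      T12 = T12 := by
    rw [hT12, congr_pair_purePacket, h0π, h1π2]
  rw [three_eq_smul_purePacket_one, ← hP11, map_smul, map_add, map_add, map_smul, hG1, hG21, hG12, hone]
  module

/-- **`(f₀ ⊗ f₁)(e₁) ∉ (R_I)^∼`** (else `e₁ − (f₀ ⊗ f₁)(e₁) = (2/3)·1 ∈ (R_I)^∼`, a subring containing `e₁`; but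
`‖2/3‖₃ = 3 > 1`). [cite: Mochizuki2012, IUTchIV Prop. 1.1 p. 9, Prop. 1.4 (i) p. 13] -/
theorem congr_pair_wildIdempotent_not_mem [IsUltrametricDist K] [ProperSpace K] (hπ : π ^ 3 = 3)
    (f : ∀ _ : Fin 2, K ≃ₗ[ℚ_[3]] K) (h0 : f 0 1 = -1) (h0π : f 0 π = π)
    (h0π2 : f 0 (π ^ 2) = π ^ 2) (h1 : f 1 1 = 1) (h1π : f 1 π = π) (h1π2 : f 1 (π ^ 2) = π ^ 2) :
    (PiTensorProduct.congr f : PacketAlgebra 3 (fun _ : Fin 2 => K) ≃ₗ[ℚ_[3]] PacketAlgebra 3 (fun _ : Fin 2 => K))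
        ((9 : ℚ_[3])⁻¹ • ((3 : PacketAlgebra 3 (fun _ : Fin 2 => K)) + purePacket 3 (fun _ : Fin 2 => K) ![π ^ 2, π]
          + purePacket 3 (fun _ : Fin 2 => K) ![π, π ^ 2])) ∉
      normalizedPacket 3 (fun _ : Fin 2 => K) := by
  intro hmem
  have he₁ := wildIdempotent_mem_normalizedPacket (K := K) hπ
  have hsub := sub_mem he₁ hmem
  rw [congr_pair_wildIdempotent f h0 h0π h0π2 h1 h1π h1π2, sub_sub_cancel, ← Algebra.algebraMap_eq_smul_one] at hsub
  refine algebraMap_not_mem_normalizedPacket 3 (fun _ : Fin 2 => K) ?_ hsub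
  have h2 : ‖(2 : ℚ_[3])‖ = 1 := by
    have h := (Padic.norm_natCast_eq_one_iff (p := 3) (n := 2)).mpr (by norm_num)
    simpa using h
  have h3 : ‖(3 : ℚ_[3])‖ = 3⁻¹ := by simpa using Padic.norm_p (p := 3)
  rw [norm_div, h2, h3]
  norm_num

/-- **`f₀ ⊗ f₁` moves a point of `(R_I)^∼` out of `(R_I)^∼`** (the idempotent `e₁`). [cite: Mochizuki2012, IUTchIV Prop. 1.1 p. 9] -/
theorem exists_mem_normalizedPacket_congr_not_mem [IsUltrametricDist K] [ProperSpace K] (hπ : π ^ 3 = 3)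
    (f : ∀ _ : Fin 2, K ≃ₗ[ℚ_[3]] K) (h0 : f 0 1 = -1) (h0π : f 0 π = π)
    (h0π2 : f 0 (π ^ 2) = π ^ 2) (h1 : f 1 1 = 1) (h1π : f 1 π = π) (h1π2 : f 1 (π ^ 2) = π ^ 2) :
    ∃ z : PacketAlgebra 3 (fun _ : Fin 2 => K),
      z ∈ (normalizedPacket 3 (fun _ : Fin 2 => K) : Set (PacketAlgebra 3 (fun _ : Fin 2 => K))) ∧
        (PiTensorProduct.congr f : PacketAlgebra 3 (fun _ : Fin 2 => K) ≃ₗ[ℚ_[3]] PacketAlgebra 3 (fun _ : Fin 2 => K)) z ∉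
          (normalizedPacket 3 (fun _ : Fin 2 => K) : Set (PacketAlgebra 3 (fun _ : Fin 2 => K))) :=
  ⟨_, wildIdempotent_mem_normalizedPacket (K := K) hπ, congr_pair_wildIdempotent_not_mem hπ f h0 h0π h0π2 h1 h1π h1π2⟩

/-- **Hence `f₀ ⊗ f₁` does NOT map `(R_I)^∼` onto itself.** [cite: Mochizuki2012, IUTchIV Prop. 1.1 p. 9] -/
theorem congr_image_normalizedPacket_ne [IsUltrametricDist K] [ProperSpace K] (hπ : π ^ 3 = 3)
    (f : ∀ _ : Fin 2, K ≃ₗ[ℚ_[3]] K) (h0 : f 0 1 = -1) (h0π : f 0 π = π)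
    (h0π2 : f 0 (π ^ 2) = π ^ 2) (h1 : f 1 1 = 1) (h1π : f 1 π = π) (h1π2 : f 1 (π ^ 2) = π ^ 2) :
    (PiTensorProduct.congr f : PacketAlgebra 3 (fun _ : Fin 2 => K) ≃ₗ[ℚ_[3]] PacketAlgebra 3 (fun _ : Fin 2 => K)) ''
        (normalizedPacket 3 (fun _ : Fin 2 => K) : Set (PacketAlgebra 3 (fun _ : Fin 2 => K))) ≠
      (normalizedPacket 3 (fun _ : Fin 2 => K) : Set (PacketAlgebra 3 (fun _ : Fin 2 => K))) := by
  intro h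
  obtain ⟨z, hz, hnot⟩ := exists_mem_normalizedPacket_congr_not_mem hπ f h0 h0π h0π2 h1 h1π h1π2
  exact hnot (h ▸ Set.mem_image_of_mem _ hz)

/-! ### The coordinate reflection `a + bπ + cπ² ↦ −a + bπ + cπ²` is an isometry -/

/-- **The reflection in the constant coordinate is a `ℚ₃`-linear ISOMETRY of `K = ℚ₃(π)`** (`[K : ℚ₃] = 3`,
`π³ = 3`): there is `f₀ : K ≃ₗ[ℚ₃] K` with `f₀ 1 = −1`, `f₀ π = π`, `f₀ π² = π²` and `‖f₀ x‖ = ‖x‖` for all `x` (the norm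
of `a + bπ + cπ²` is `max(‖a‖, ‖b‖‖π‖, ‖c‖‖π‖²)`, unchanged under `a ↦ −a`). [cite: NeukirchANT1999, Ch. II (5.5)] -/
theorem exists_reflection_isometry [IsUltrametricDist K] (hK : Module.finrank ℚ_[3] K = 3) (hπ : π ^ 3 = 3) :
    ∃ f₀ : K ≃ₗ[ℚ_[3]] K, f₀ 1 = -1 ∧ f₀ π = π ∧ f₀ (π ^ 2) = π ^ 2 ∧ ∀ x, ‖f₀ x‖ = ‖x‖ := by
  have hli := WildCubic.linearIndependent_one_pi_pi_sq hπ
  let B := basisOfLinearIndependentOfCardEqFinrank hli (by rw [hK, Fintype.card_fin])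
  have hB : ⇑B = ![(1 : K), π, π ^ 2] := coe_basisOfLinearIndependentOfCardEqFinrank _ _
  have hB0 : B 0 = 1 := by rw [hB]; rfl
  have hB1 : B 1 = π := by rw [hB]; rfl
  have hB2 : B 2 = π ^ 2 := by rw [hB]; rfl
  have h2 : ((2 : ℚ_[3]) • B.coord 0) (1 : K) = 2 := by
    rw [LinearMap.smul_apply, B.coord_apply, WildCubic.repr_one_zero B hB0, smul_eq_mul, mul_one]
  refine ⟨Module.reflection h2, Module.reflection_apply_self h2, ?_, ?_, fun x => ?_⟩
  · rw [Module.reflection_apply, LinearMap.smul_apply, B.coord_apply, WildCubic.repr_pi_zero B hB1, smul_zero,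
      zero_smul, sub_zero]
  · rw [Module.reflection_apply, LinearMap.smul_apply, B.coord_apply, WildCubic.repr_pi_sq_zero B hB2, smul_zero,
      zero_smul, sub_zero]
  · have hx := WildCubic.eq_combo B hB0 hB1 hB2 x
    have hgx : Module.reflection h2 x =
        (-(B.repr x 0)) • (1 : K) + B.repr x 1 • π + B.repr x 2 • π ^ 2 :=
      calc Module.reflection h2 x = x - ((2 : ℚ_[3]) * B.repr x 0) • (1 : K) := by
            rw [Module.reflection_apply, LinearMap.smul_apply, B.coord_apply, smul_eq_mul]
        _ = (B.repr x 0 • (1 : K) + B.repr x 1 • π + B.repr x 2 • π ^ 2) - ((2 : ℚ_[3]) * B.repr x 0) • (1 : K) := by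
            rw [← hx]
        _ = (-(B.repr x 0)) • (1 : K) + B.repr x 1 • π + B.repr x 2 • π ^ 2 := by module
    rw [hgx, WildCubic.norm_combo hπ, norm_neg, ← WildCubic.norm_eq_max B hπ hB0 hB1 hB2 x]

/-- **WILD ISOMETRY MOVER (basis-free form).**  `[K : ℚ₃] = 3`, `π³ = 3`: there is a `ℚ₃`-linear isometry `f₀` of
`K` (`‖f₀ x‖ = ‖x‖`, so `f₀(𝒪_K) = 𝒪_K` and `f₀(𝔪^n) = 𝔪^n`) and a point `z` of the maximal order `(R_I)^∼` of `K ⊗_{ℚ₃} K`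
with `(f₀ ⊗ 1)(z) ∉ (R_I)^∼`. [cite: Mochizuki2012, IUTchIV Prop. 1.1 p. 9] [cite: NeukirchANT1999, Ch. II (5.5)] -/
theorem exists_isometry_maxOrder_mover [IsUltrametricDist K] [ProperSpace K] (hK : Module.finrank ℚ_[3] K = 3)
    (hπ : π ^ 3 = 3) :
    ∃ f₀ : K ≃ₗ[ℚ_[3]] K, (∀ x, ‖f₀ x‖ = ‖x‖) ∧ (∀ r : ℝ, f₀ '' closedBall (0 : K) r = closedBall 0 r) ∧
      ∃ z : PacketAlgebra 3 (fun _ : Fin 2 => K),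
        z ∈ (normalizedPacket 3 (fun _ : Fin 2 => K) : Set (PacketAlgebra 3 (fun _ : Fin 2 => K))) ∧
          (PiTensorProduct.congr (![f₀, LinearEquiv.refl ℚ_[3] K] : ∀ _ : Fin 2, K ≃ₗ[ℚ_[3]] K) :
              PacketAlgebra 3 (fun _ : Fin 2 => K) ≃ₗ[ℚ_[3]] PacketAlgebra 3 (fun _ : Fin 2 => K)) z ∉
            (normalizedPacket 3 (fun _ : Fin 2 => K) : Set (PacketAlgebra 3 (fun _ : Fin 2 => K))) := by
  obtain ⟨f₀, h0, h0π, h0π2, hiso⟩ := exists_reflection_isometry (K := K) hK hπ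
  exact ⟨f₀, hiso, image_closedBall_eq_of_norm_map_eq 3 f₀ hiso,
    exists_mem_normalizedPacket_congr_not_mem hπ _ h0 h0π h0π2 rfl rfl rfl⟩

end Wild

/-! ## Non-vacuity: `ℚ₃(∛3) ⊆ ℚ̄₃` -/

/-- **NON-VACUITY OF THE WILD ISOMETRY MOVER.**  For some finite `E ⊆ ℚ̄₃` (namely `E = ℚ₃(∛3)`,
`exists_wildCubic_subfield`) there are a `ℚ₃`-linear ISOMETRY `g` of `E` (mapping `𝒪_E` and every `𝔪_E^n` onto
themselves) and a point `z` of the maximal order `(R_I)^∼` of the two-factor packet `E ⊗_{ℚ₃} E` with `(g ⊗ 1)(z) ∉ (R_I)^∼`: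
factorwise `𝒪`-stable `ℚ_p`-isometries need NOT fix the maximal order of a tensor packet at a wild place.
[cite: Mochizuki2012, IUTchIV Prop. 1.1 p. 9] [cite: NeukirchANT1999, Ch. II (5.5)] -/
theorem exists_wildCubic_isometry_maxOrder_mover :
    ∃ (E : IntermediateField ℚ_[3] (PadicAlgCl 3)) (_ : FiniteDimensional ℚ_[3] E) (g : E ≃ₗ[ℚ_[3]] E),
      (∀ x, ‖g x‖ = ‖x‖) ∧ (∀ r : ℝ, g '' closedBall (0 : E) r = closedBall 0 r) ∧
        ∃ z : PacketAlgebra 3 (fun _ : Fin 2 => (E : Type)),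
          z ∈ (normalizedPacket 3 (fun _ : Fin 2 => (E : Type)) : Set (PacketAlgebra 3 (fun _ : Fin 2 => (E : Type)))) ∧
            (PiTensorProduct.congr (![g, LinearEquiv.refl ℚ_[3] E] : ∀ _ : Fin 2, (E : Type) ≃ₗ[ℚ_[3]] E) :
                PacketAlgebra 3 (fun _ : Fin 2 => (E : Type)) ≃ₗ[ℚ_[3]] PacketAlgebra 3 (fun _ : Fin 2 => (E : Type))) z ∉
              (normalizedPacket 3 (fun _ : Fin 2 => (E : Type)) : Set (PacketAlgebra 3 (fun _ : Fin 2 => (E : Type)))) := by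
  obtain ⟨E, π, hfd, hK, hπ⟩ := exists_wildCubic_subfield
  exact ⟨E, hfd, exists_isometry_maxOrder_mover (K := E) hK hπ⟩

end Literature.IUT.LogVolume

end
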